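import Mathlib
import HarnessLib
import Literature.MathematicalPhysics.QuantumFieldTheory.ConstructiveQFTWave0
import Summits.Ventures.LatticeQCDFlow.Scaling.SparsePatchSectors
import Summits.Ventures.LatticeQCDFlow.Scaling.SparsePatchSectorsLattice
import Summits.Ventures.LatticeQCDFlow.Scaling.SparsePatchSectorsLatticeGroups
import Summits.Ventures.LatticeQCDFlow.Scaling.ExposedPatchSectors

/-!
# LatticeQCDFlow / Scaling — the EXPOSED-PATCH tunnelling law on the lattice: plaquette, planar and time-slice updates for `SU(N)` and `U(N)` (v3.2, item 85b)

HONEST FRAMING: exact (Metropolis-corrected) sampling algorithms for lattice gauge theory; figures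
of merit are autocorrelation/cost numbers at stated couplings and volumes; no continuum-physics
claim.

THEORY-2.md §3.3 / conjecture C7(b), SECOND STEP, lattice part (abstract law:
`Scaling/ExposedPatchSectors.lean`):

* `dist_plaqSlot_le_of_eq_off_slot` — on the lattice EVERY slot of every plaquette detects
  (bi-invariant metric); **`exposed_of_slab`** — a link set lying in a SLAB `{e | e.2 ≠ l, e.1 l = a}`
  (all links inside the hyperplane `x_l = a`, none in direction `l`; `L ≥ 2`) is exposed, through the
  plaquettes in direction `l`: this contains the four links of ONE PLAQUETTE (`d ≥ 3`), any PLANAR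
  patch (`d ≥ 3`) and, in `d = 4`, ALL SPATIAL LINKS OF A TIME SLICE updated at once;
* **`compProd_sector_ne_le_of_exposedLinks` / `…_of_slab`**, `measure_sector_ne_le_nsteps_of_exposedLinks`
  (generic `G`, local paths `(ρ, r)` as a hypothesis, `2c ≤ ρ`, `c + 4r ≤ ε`);
* **`SUN.compProd_sector_ne_le_of_exposedLinks` / `SUN.compProd_sector_ne_le_of_slab` /
  `SUN.measure_sector_ne_le_nsteps_of_exposedLinks`**: `∃ r₀ = r₀(N) > 0 ∀ 0 ≤ c, 2c ≤ r₀, 9c ≤ ε`, every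
  `d`, `L ≥ 2`, every law `μ`, every `μ`-invariant kernel updating an exposed / slab link set:
  `(μ ⊗ₘ κ){sector_ε ≠ sector_ε'} ≤ 2·μ{∃ p touching Λ, dist(U_p, 1) ≥ c}`;
* **`UN.compProd_sector_ne_le_of_slab`**: the same with the explicit `0 ≤ c ≤ 1/16`, `17c ≤ ε`.

NOT covered here: update sets with an UNEXPOSED link (e.g. all links of a solid `l^d` block, `l ≥ 3`) —
see `Scaling/GaugeFixedPatchSectors*.lean` and `Scaling/Box*.lean`.  No sorry, no new axioms, no `def`.
-/

noncomputable section

open scoped Matrix.Norms.Frobenius ENNReal ProbabilityTheory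
open MeasureTheory ProbabilityTheory Metric Set
open Literature.MathematicalPhysics.QuantumFieldTheory

/-! ## §1. The lattice: every slot detects; slabs are exposed -/

namespace Summit.Ventures.LatticeQCDFlow.Theory2.Lattice

variable {d L : ℕ}

section Generic

variable {G : Type*} [Group G] [PseudoMetricSpace G]

/-- Slot `0` detects: with the other three slots frozen, `dist (U_e, V_e) ≤ dist (U_p, 1) + dist (V_p, 1)`. [folklore] -/
theorem dist_plaqSlot_zero_le
    (hr : ∀ a b c : G, dist (a * c) (b * c) = dist a b) (p : Plaquette d L) (U V : GaugeConfig d L G)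
    (h : ∀ s', s' ≠ (0 : Fin 4) → U (plaqSlot p s') = V (plaqSlot p s')) :
    dist (U (plaqSlot p 0)) (V (plaqSlot p 0)) ≤ dist (plaquetteHolonomy U p.1 p.2.1.1 p.2.1.2) 1 +
      dist (plaquetteHolonomy V p.1 p.2.1.1 p.2.1.2) 1 := by
  have h1 := h 1 (by decide)
  have h2 := h 2 (by decide)
  have h3 := h 3 (by decide)
  simp only [plaqSlot_zero, plaqSlot_one, plaqSlot_two, plaqSlot_three] at h1 h2 h3 ⊢
  have he : dist (U (p.1, p.2.1.1)) (V (p.1, p.2.1.1)) =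
      dist (plaquetteHolonomy U p.1 p.2.1.1 p.2.1.2) (plaquetteHolonomy V p.1 p.2.1.1 p.2.1.2) := by
    unfold plaquetteHolonomy
    rw [← h1, ← h2, ← h3, hr, hr, hr]
  calc dist (U (p.1, p.2.1.1)) (V (p.1, p.2.1.1)) = _ := he
    _ ≤ dist (plaquetteHolonomy U p.1 p.2.1.1 p.2.1.2) 1 +
        dist 1 (plaquetteHolonomy V p.1 p.2.1.1 p.2.1.2) := dist_triangle _ _ _
    _ = _ := by rw [dist_comm (1 : G)]

/-- Slot `1` detects. [folklore] -/
theorem dist_plaqSlot_one_le (hl : ∀ a b c : G, dist (a * b) (a * c) = dist b c)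
    (hr : ∀ a b c : G, dist (a * c) (b * c) = dist a b) (p : Plaquette d L) (U V : GaugeConfig d L G)
    (h : ∀ s', s' ≠ (1 : Fin 4) → U (plaqSlot p s') = V (plaqSlot p s')) :
    dist (U (plaqSlot p 1)) (V (plaqSlot p 1)) ≤ dist (plaquetteHolonomy U p.1 p.2.1.1 p.2.1.2) 1 +
      dist (plaquetteHolonomy V p.1 p.2.1.1 p.2.1.2) 1 := by
  have h0 := h 0 (by decide)
  have h2 := h 2 (by decide)
  have h3 := h 3 (by decide)
  simp only [plaqSlot_zero, plaqSlot_one, plaqSlot_two, plaqSlot_three] at h0 h2 h3 ⊢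
  have he : dist (U (p.1.shift p.2.1.1, p.2.1.2)) (V (p.1.shift p.2.1.1, p.2.1.2)) =
      dist (plaquetteHolonomy U p.1 p.2.1.1 p.2.1.2) (plaquetteHolonomy V p.1 p.2.1.1 p.2.1.2) := by
    unfold plaquetteHolonomy
    rw [← h0, ← h2, ← h3, hr, hr, hl]
  calc dist (U (p.1.shift p.2.1.1, p.2.1.2)) (V (p.1.shift p.2.1.1, p.2.1.2)) = _ := he
    _ ≤ dist (plaquetteHolonomy U p.1 p.2.1.1 p.2.1.2) 1 +
        dist 1 (plaquetteHolonomy V p.1 p.2.1.1 p.2.1.2) := dist_triangle _ _ _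
    _ = _ := by rw [dist_comm (1 : G)]

/-- Slot `2` detects. [folklore] -/
theorem dist_plaqSlot_two_le (hl : ∀ a b c : G, dist (a * b) (a * c) = dist b c)
    (hr : ∀ a b c : G, dist (a * c) (b * c) = dist a b) (p : Plaquette d L) (U V : GaugeConfig d L G)
    (h : ∀ s', s' ≠ (2 : Fin 4) → U (plaqSlot p s') = V (plaqSlot p s')) :
    dist (U (plaqSlot p 2)) (V (plaqSlot p 2)) ≤ dist (plaquetteHolonomy U p.1 p.2.1.1 p.2.1.2) 1 +
      dist (plaquetteHolonomy V p.1 p.2.1.1 p.2.1.2) 1 := by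
  have hi := dist_inv_inv_of_biInvariant hl hr
  have h0 := h 0 (by decide)
  have h1 := h 1 (by decide)
  have h3 := h 3 (by decide)
  simp only [plaqSlot_zero, plaqSlot_one, plaqSlot_two, plaqSlot_three] at h0 h1 h3 ⊢
  have he : dist (U (p.1.shift p.2.1.2, p.2.1.1)) (V (p.1.shift p.2.1.2, p.2.1.1)) =
      dist (plaquetteHolonomy U p.1 p.2.1.1 p.2.1.2) (plaquetteHolonomy V p.1 p.2.1.1 p.2.1.2) := by
    unfold plaquetteHolonomy
    rw [← h0, ← h1, ← h3, hr, hl, hi]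
  calc dist (U (p.1.shift p.2.1.2, p.2.1.1)) (V (p.1.shift p.2.1.2, p.2.1.1)) = _ := he
    _ ≤ dist (plaquetteHolonomy U p.1 p.2.1.1 p.2.1.2) 1 +
        dist 1 (plaquetteHolonomy V p.1 p.2.1.1 p.2.1.2) := dist_triangle _ _ _
    _ = _ := by rw [dist_comm (1 : G)]

/-- Slot `3` detects. [folklore] -/
theorem dist_plaqSlot_three_le (hl : ∀ a b c : G, dist (a * b) (a * c) = dist b c)
    (hr : ∀ a b c : G, dist (a * c) (b * c) = dist a b) (p : Plaquette d L) (U V : GaugeConfig d L G)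
    (h : ∀ s', s' ≠ (3 : Fin 4) → U (plaqSlot p s') = V (plaqSlot p s')) :
    dist (U (plaqSlot p 3)) (V (plaqSlot p 3)) ≤ dist (plaquetteHolonomy U p.1 p.2.1.1 p.2.1.2) 1 +
      dist (plaquetteHolonomy V p.1 p.2.1.1 p.2.1.2) 1 := by
  have hi := dist_inv_inv_of_biInvariant hl hr
  have h0 := h 0 (by decide)
  have h1 := h 1 (by decide)
  have h2 := h 2 (by decide)
  simp only [plaqSlot_zero, plaqSlot_one, plaqSlot_two, plaqSlot_three] at h0 h1 h2 ⊢
  have he : dist (U (p.1, p.2.1.2)) (V (p.1, p.2.1.2)) =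
      dist (plaquetteHolonomy U p.1 p.2.1.1 p.2.1.2) (plaquetteHolonomy V p.1 p.2.1.1 p.2.1.2) := by
    unfold plaquetteHolonomy
    rw [← h0, ← h1, ← h2, hl, hi]
  calc dist (U (p.1, p.2.1.2)) (V (p.1, p.2.1.2)) = _ := he
    _ ≤ dist (plaquetteHolonomy U p.1 p.2.1.1 p.2.1.2) 1 +
        dist 1 (plaquetteHolonomy V p.1 p.2.1.1 p.2.1.2) := dist_triangle _ _ _
    _ = _ := by rw [dist_comm (1 : G)]

/-- **Every slot detects** (bi-invariant metric): freezing the other three slots, the displacement of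
the remaining link is the displacement of the plaquette, `≤ dist (U_p, 1) + dist (V_p, 1)`. [folklore] -/
theorem dist_plaqSlot_le_of_eq_off_slot (hl : ∀ a b c : G, dist (a * b) (a * c) = dist b c)
    (hr : ∀ a b c : G, dist (a * c) (b * c) = dist a b) (p : Plaquette d L) (s : Fin 4)
    (U V : GaugeConfig d L G) (h : ∀ s', s' ≠ s → U (plaqSlot p s') = V (plaqSlot p s')) :
    dist (U (plaqSlot p s)) (V (plaqSlot p s)) ≤ dist (plaquetteHolonomy U p.1 p.2.1.1 p.2.1.2) 1 +
      dist (plaquetteHolonomy V p.1 p.2.1.1 p.2.1.2) 1 := by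
  fin_cases s
  · exact dist_plaqSlot_zero_le hr p U V h
  · exact dist_plaqSlot_one_le hl hr p U V h
  · exact dist_plaqSlot_two_le hl hr p U V h
  · exact dist_plaqSlot_three_le hl hr p U V h

end Generic

/-- **Slabs are exposed.**  If every link of `Λ` lies in the hyperplane `{x_l = a}` and none points in
direction `l` (`L ≥ 2`), then every link of `Λ` is a slot of a plaquette in direction `l` whose other
three slots are outside `Λ` (two point in direction `l`, the third lies in the hyperplane `{x_l = a + 1}`).
Examples: the four links of one plaquette (`d ≥ 3`), any planar patch (`d ≥ 3`), all spatial links of a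
time slice (`d = 4`). [folklore] -/
theorem exposed_of_slab [NeZero L] (hL : 2 ≤ L) (l : Fin d) (a : ZMod L) {Λ : Set (Edge d L)}
    (hΛ : ∀ e ∈ Λ, e.2 ≠ l ∧ e.1 l = a) :
    ∀ e ∈ Λ, ∃ (p : Plaquette d L) (s : Fin 4), plaqSlot p s = e ∧
      ∀ s', s' ≠ s → plaqSlot p s' ∉ Λ := by
  haveI : Fact (1 < L) := ⟨hL⟩
  rintro ⟨y, κ⟩ he
  obtain ⟨hκ, hy⟩ := hΛ _ he
  dsimp only at hκ hy
  have hdir : ∀ z : Site d L, (z, l) ∉ Λ := fun z hz => (hΛ _ hz).1 rfl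
  have hup : ∀ κ' : Fin d, (y.shift l, κ') ∉ Λ := fun κ' hz => by
    have h2 := (hΛ _ hz).2
    dsimp only at h2
    simp only [Site.shift, Pi.add_apply, Pi.single_eq_same, hy] at h2
    exact absurd h2 (by simp)
  rcases lt_or_gt_of_ne hκ with hκl | hlκ
  · refine ⟨(y, ⟨(κ, l), hκl⟩), 0, rfl, fun s' hs' => ?_⟩
    fin_cases s'
    · exact absurd rfl hs'
    · exact hdir _
    · exact hup _
    · exact hdir _
  · refine ⟨(y, ⟨(l, κ), hlκ⟩), 3, rfl, fun s' hs' => ?_⟩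
    fin_cases s'
    · exact hdir _
    · exact hup _
    · exact hdir _
    · exact absurd rfl hs'

/-- The four links of a plaquette `p = (x; i < j)` lie in the slab of any third direction `l ∉ {i, j}`.
[folklore] -/
theorem range_plaqSlot_subset_slab (p : Plaquette d L) {l : Fin d} (hli : l ≠ p.2.1.1)
    (hlj : l ≠ p.2.1.2) : ∀ e ∈ Set.range (plaqSlot p), e.2 ≠ l ∧ e.1 l = p.1 l := by
  rintro _ ⟨s, rfl⟩
  fin_cases s
  · exact ⟨hli.symm, rfl⟩
  · refine ⟨hlj.symm, ?_⟩
    show (p.1.shift p.2.1.1) l = p.1 l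
    simp [Site.shift, hli]
  · refine ⟨hli.symm, ?_⟩
    show (p.1.shift p.2.1.2) l = p.1 l
    simp [Site.shift, hlj]
  · exact ⟨hlj.symm, rfl⟩

/-- In `d ≥ 3` every plaquette has a third direction. [folklore] -/
theorem exists_third_dir (hd : 3 ≤ d) (i j : Fin d) : ∃ l : Fin d, l ≠ i ∧ l ≠ j := by
  have key : ∀ k, k < d → k ≠ i.val → k ≠ j.val → ∃ l : Fin d, l ≠ i ∧ l ≠ j :=
    fun k hk h1 h2 => ⟨⟨k, hk⟩, fun h => h1 (by rw [← h]), fun h => h2 (by rw [← h])⟩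
  by_cases hi0 : i.val = 0
  · by_cases hj1 : j.val = 1
    · exact key 2 (by omega) (by omega) (by omega)
    · exact key 1 (by omega) (by omega) (by omega)
  · by_cases hj0 : j.val = 0
    · by_cases hi1 : i.val = 1
      · exact key 2 (by omega) (by omega) (by omega)
      · exact key 1 (by omega) (by omega) (by omega)
    · exact key 0 (by omega) (by omega) (by omega)

section GenericLaws

variable {G : Type*} [Group G] [PseudoMetricSpace G] [MeasurableSpace G]

/-- **Exposed-links tunnelling law** (generic `G`, bi-invariant metric, `(ρ, r)`-local paths; `2c ≤ ρ`,
`c + 4r ≤ ε`; `Λ` exposed): `(μ ⊗ₘ κ){sector_ε ≠ sector_ε'} ≤ 2·μ{∃ p touching Λ, dist (U_p, 1) ≥ c}`.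
[folklore] -/
theorem compProd_sector_ne_le_of_exposedLinks
    (hl : ∀ a b c : G, dist (a * b) (a * c) = dist b c) (hr : ∀ a b c : G, dist (a * c) (b * c) = dist a b)
    {ρ r : ℝ} (hr0 : 0 ≤ r)
    (hpath : ∀ g g' : G, dist g g' ≤ ρ → ∃ γ : ℝ → G, ContinuousOn γ (Icc (0 : ℝ) 1) ∧ γ 0 = g ∧
      γ 1 = g' ∧ ∀ t ∈ Icc (0 : ℝ) 1, dist (γ t) g ≤ r)
    {c ε : ℝ} (hcρ : 2 * c ≤ ρ) (hcr : c + 4 * r ≤ ε) {Λ : Set (Edge d L)}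
    (hΛ : ∀ e ∈ Λ, ∃ (p : Plaquette d L) (s : Fin 4), plaqSlot p s = e ∧ ∀ s', s' ≠ s → plaqSlot p s' ∉ Λ)
    (μ : Measure (GaugeConfig d L G)) [SFinite μ]
    (κ : Kernel (GaugeConfig d L G) (GaugeConfig d L G)) [IsMarkovKernel κ] (hinv : κ.Invariant μ)
    (hmove : ∀ᵐ q ∂(μ ⊗ₘ κ), ∀ e ∉ Λ, q.1 e = q.2 e) :
    (μ ⊗ₘ κ) {q | connectedComponentIn
          {W : GaugeConfig d L G | ∀ p : Plaquette d L, dist (plaquetteHolonomy W p.1 p.2.1.1 p.2.1.2) 1 < ε} q.1 ≠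
        connectedComponentIn
          {W : GaugeConfig d L G | ∀ p : Plaquette d L, dist (plaquetteHolonomy W p.1 p.2.1.1 p.2.1.2) 1 < ε} q.2} ≤
      2 * μ {U | ∃ (p : Plaquette d L) (s : Fin 4), plaqSlot p s ∈ Λ ∧
        c ≤ dist (plaquetteHolonomy U p.1 p.2.1.1 p.2.1.2) 1} :=
  Tunnelling.compProd_sector_ne_le_of_exposedPatch
    (a := fun (p : Plaquette d L) (W : GaugeConfig d L G) => dist (plaquetteHolonomy W p.1 p.2.1.1 p.2.1.2) 1)
    (slot := plaqSlot) (dist_plaquetteHolonomy_one_le hl hr)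
    (fun p s U V h => dist_plaqSlot_le_of_eq_off_slot hl hr p s U V h) hΛ hr0 hpath hcρ
    (by rw [Fintype.card_fin, Nat.cast_ofNat]; exact hcr) μ κ hinv hmove

/-- **Slab tunnelling law** (`L ≥ 2`; `Λ` inside the hyperplane `{x_l = a}` with no link in direction
`l` — one plaquette, a planar patch, a whole time slice of spatial links). [folklore] -/
theorem compProd_sector_ne_le_of_slab [NeZero L] (hL : 2 ≤ L)
    (hl : ∀ a b c : G, dist (a * b) (a * c) = dist b c) (hr : ∀ a b c : G, dist (a * c) (b * c) = dist a b)
    {ρ r : ℝ} (hr0 : 0 ≤ r)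
    (hpath : ∀ g g' : G, dist g g' ≤ ρ → ∃ γ : ℝ → G, ContinuousOn γ (Icc (0 : ℝ) 1) ∧ γ 0 = g ∧
      γ 1 = g' ∧ ∀ t ∈ Icc (0 : ℝ) 1, dist (γ t) g ≤ r)
    {c ε : ℝ} (hcρ : 2 * c ≤ ρ) (hcr : c + 4 * r ≤ ε) (l : Fin d) (a : ZMod L) {Λ : Set (Edge d L)}
    (hΛ : ∀ e ∈ Λ, e.2 ≠ l ∧ e.1 l = a)
    (μ : Measure (GaugeConfig d L G)) [SFinite μ]
    (κ : Kernel (GaugeConfig d L G) (GaugeConfig d L G)) [IsMarkovKernel κ] (hinv : κ.Invariant μ)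
    (hmove : ∀ᵐ q ∂(μ ⊗ₘ κ), ∀ e ∉ Λ, q.1 e = q.2 e) :
    (μ ⊗ₘ κ) {q | connectedComponentIn
          {W : GaugeConfig d L G | ∀ p : Plaquette d L, dist (plaquetteHolonomy W p.1 p.2.1.1 p.2.1.2) 1 < ε} q.1 ≠
        connectedComponentIn
          {W : GaugeConfig d L G | ∀ p : Plaquette d L, dist (plaquetteHolonomy W p.1 p.2.1.1 p.2.1.2) 1 < ε} q.2} ≤
      2 * μ {U | ∃ (p : Plaquette d L) (s : Fin 4), plaqSlot p s ∈ Λ ∧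
        c ≤ dist (plaquetteHolonomy U p.1 p.2.1.1 p.2.1.2) 1} :=
  compProd_sector_ne_le_of_exposedLinks hl hr hr0 hpath hcρ hcr (exposed_of_slab hL l a hΛ) μ κ hinv hmove

/-- **`n`-step law for exposed link sets** (step `k` changes only the exposed set `Λ k`; marginals `m`).
[folklore] -/
theorem measure_sector_ne_le_nsteps_of_exposedLinks
    (hl : ∀ a b c : G, dist (a * b) (a * c) = dist b c) (hr : ∀ a b c : G, dist (a * c) (b * c) = dist a b)
    {ρ r : ℝ} (hr0 : 0 ≤ r)
    (hpath : ∀ g g' : G, dist g g' ≤ ρ → ∃ γ : ℝ → G, ContinuousOn γ (Icc (0 : ℝ) 1) ∧ γ 0 = g ∧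
      γ 1 = g' ∧ ∀ t ∈ Icc (0 : ℝ) 1, dist (γ t) g ≤ r)
    {c ε : ℝ} (hcρ : 2 * c ≤ ρ) (hcr : c + 4 * r ≤ ε) {Λ : ℕ → Set (Edge d L)}
    (hΛ : ∀ k, ∀ e ∈ Λ k, ∃ (p : Plaquette d L) (s : Fin 4), plaqSlot p s = e ∧
      ∀ s', s' ≠ s → plaqSlot p s' ∉ Λ k)
    {Ω : Type*} [MeasurableSpace Ω] (P : Measure Ω) (Z : ℕ → Ω → GaugeConfig d L G)
    (hZ : ∀ k, Measurable (Z k)) (m : Measure (GaugeConfig d L G)) (hmarg : ∀ k, P.map (Z k) = m)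
    (hstep : ∀ k, ∀ᵐ ω ∂P, ∀ e ∉ Λ k, Z k ω e = Z (k + 1) ω e) {M : ℝ≥0∞}
    (hM : ∀ k, m {U | ∃ (p : Plaquette d L) (s : Fin 4), plaqSlot p s ∈ Λ k ∧
      c ≤ dist (plaquetteHolonomy U p.1 p.2.1.1 p.2.1.2) 1} ≤ M) (n : ℕ) :
    P {ω | connectedComponentIn
          {W : GaugeConfig d L G | ∀ p : Plaquette d L, dist (plaquetteHolonomy W p.1 p.2.1.1 p.2.1.2) 1 < ε} (Z n ω) ≠
        connectedComponentIn
          {W : GaugeConfig d L G | ∀ p : Plaquette d L, dist (plaquetteHolonomy W p.1 p.2.1.1 p.2.1.2) 1 < ε} (Z 0 ω)} ≤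
      n * (2 * M) :=
  Tunnelling.measure_sector_ne_le_nsteps_of_exposedPatches
    (a := fun (p : Plaquette d L) (W : GaugeConfig d L G) => dist (plaquetteHolonomy W p.1 p.2.1.1 p.2.1.2) 1)
    (slot := plaqSlot) (dist_plaquetteHolonomy_one_le hl hr)
    (fun p s U V h => dist_plaqSlot_le_of_eq_off_slot hl hr p s U V h) hΛ hr0 hpath hcρ
    (by rw [Fintype.card_fin, Nat.cast_ofNat]; exact hcr) P Z hZ m hmarg hstep hM n

end GenericLaws

end Summit.Ventures.LatticeQCDFlow.Theory2.Lattice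

/-! ## §2. `SU(N)`: thresholds `2c ≤ r₀(N)`, `9c ≤ ε` -/

namespace Summit.Ventures.LatticeQCDFlow.Theory2.Lattice.SUN

open Summit.Ventures.LatticeQCDFlow.Theory2.Lattice

variable {N : ℕ}

/-- **`SU(N)` exposed-links tunnelling law**: `∃ r₀ = r₀(N) > 0` such that for all `0 ≤ c`, `2c ≤ r₀`,
`9c ≤ ε`, every `d`, `L`, every exposed `Λ`, every s-finite `μ` and every `μ`-invariant Markov kernel
moving only `Λ`: `(μ ⊗ₘ κ){sector_ε ≠ sector_ε'} ≤ 2·μ{∃ p touching Λ, dist (U_p, 1) ≥ c}`. [folklore] -/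
theorem compProd_sector_ne_le_of_exposedLinks : ∃ r₀ : ℝ, 0 < r₀ ∧ ∀ c ε : ℝ, 0 ≤ c → 2 * c ≤ r₀ →
    9 * c ≤ ε → ∀ {d L : ℕ} {Λ : Set (Edge d L)},
      (∀ e ∈ Λ, ∃ (p : Plaquette d L) (s : Fin 4), plaqSlot p s = e ∧ ∀ s', s' ≠ s → plaqSlot p s' ∉ Λ) →
      ∀ (μ : Measure (GaugeConfig d L (Matrix.specialUnitaryGroup (Fin N) ℂ))) [SFinite μ]
        (κ : Kernel (GaugeConfig d L (Matrix.specialUnitaryGroup (Fin N) ℂ))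
          (GaugeConfig d L (Matrix.specialUnitaryGroup (Fin N) ℂ))) [IsMarkovKernel κ],
        κ.Invariant μ → (∀ᵐ q ∂(μ ⊗ₘ κ), ∀ e ∉ Λ, q.1 e = q.2 e) →
        (μ ⊗ₘ κ) {q | connectedComponentIn
              {W | ∀ p : Plaquette d L, dist (plaquetteHolonomy W p.1 p.2.1.1 p.2.1.2) 1 < ε} q.1 ≠
            connectedComponentIn
              {W | ∀ p : Plaquette d L, dist (plaquetteHolonomy W p.1 p.2.1.1 p.2.1.2) 1 < ε} q.2} ≤
          2 * μ {U | ∃ (p : Plaquette d L) (s : Fin 4), plaqSlot p s ∈ Λ ∧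
            c ≤ dist (plaquetteHolonomy U p.1 p.2.1.1 p.2.1.2) 1} := by
  obtain ⟨r₀, hr₀, hpath⟩ := exists_localPaths_radius (N := N)
  refine ⟨r₀, hr₀, fun c ε hc0 hc hcε d L Λ hΛ μ _ κ _ hinv hmove => ?_⟩
  exact Lattice.compProd_sector_ne_le_of_exposedLinks dist_mul_left dist_mul_right (r := 2 * c)
    (by linarith) (hpath (2 * c) hc) (le_refl _) (by linarith) hΛ μ κ hinv hmove

/-- **`SU(N)` slab tunnelling law** (`L ≥ 2`; one plaquette, a planar patch or a time slice of spatial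
links updated at once by any exact kernel for any law `μ`). [folklore] -/
theorem compProd_sector_ne_le_of_slab : ∃ r₀ : ℝ, 0 < r₀ ∧ ∀ c ε : ℝ, 0 ≤ c → 2 * c ≤ r₀ →
    9 * c ≤ ε → ∀ {d L : ℕ} [NeZero L], 2 ≤ L → ∀ (l : Fin d) (a : ZMod L) {Λ : Set (Edge d L)},
      (∀ e ∈ Λ, e.2 ≠ l ∧ e.1 l = a) →
      ∀ (μ : Measure (GaugeConfig d L (Matrix.specialUnitaryGroup (Fin N) ℂ))) [SFinite μ]
        (κ : Kernel (GaugeConfig d L (Matrix.specialUnitaryGroup (Fin N) ℂ))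
          (GaugeConfig d L (Matrix.specialUnitaryGroup (Fin N) ℂ))) [IsMarkovKernel κ],
        κ.Invariant μ → (∀ᵐ q ∂(μ ⊗ₘ κ), ∀ e ∉ Λ, q.1 e = q.2 e) →
        (μ ⊗ₘ κ) {q | connectedComponentIn
              {W | ∀ p : Plaquette d L, dist (plaquetteHolonomy W p.1 p.2.1.1 p.2.1.2) 1 < ε} q.1 ≠
            connectedComponentIn
              {W | ∀ p : Plaquette d L, dist (plaquetteHolonomy W p.1 p.2.1.1 p.2.1.2) 1 < ε} q.2} ≤
          2 * μ {U | ∃ (p : Plaquette d L) (s : Fin 4), plaqSlot p s ∈ Λ ∧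
            c ≤ dist (plaquetteHolonomy U p.1 p.2.1.1 p.2.1.2) 1} := by
  obtain ⟨r₀, hr₀, h⟩ := compProd_sector_ne_le_of_exposedLinks (N := N)
  refine ⟨r₀, hr₀, fun c ε hc0 hc hcε d L _ hL l a Λ hΛ μ _ κ _ hinv hmove => ?_⟩
  exact h c ε hc0 hc hcε (exposed_of_slab hL l a hΛ) μ κ hinv hmove

/-- **`SU(N)` `n`-step law for exposed link sets.** [folklore] -/
theorem measure_sector_ne_le_nsteps_of_exposedLinks : ∃ r₀ : ℝ, 0 < r₀ ∧ ∀ c ε : ℝ, 0 ≤ c →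
    2 * c ≤ r₀ → 9 * c ≤ ε → ∀ {d L : ℕ} {Λ : ℕ → Set (Edge d L)},
      (∀ k, ∀ e ∈ Λ k, ∃ (p : Plaquette d L) (s : Fin 4), plaqSlot p s = e ∧
        ∀ s', s' ≠ s → plaqSlot p s' ∉ Λ k) →
      ∀ {Ω : Type*} [MeasurableSpace Ω] (P : Measure Ω)
        (Z : ℕ → Ω → GaugeConfig d L (Matrix.specialUnitaryGroup (Fin N) ℂ)),
      (∀ k, Measurable (Z k)) → ∀ m : Measure (GaugeConfig d L (Matrix.specialUnitaryGroup (Fin N) ℂ)),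
      (∀ k, P.map (Z k) = m) → (∀ k, ∀ᵐ ω ∂P, ∀ e ∉ Λ k, Z k ω e = Z (k + 1) ω e) →
      ∀ {M : ℝ≥0∞}, (∀ k, m {U | ∃ (p : Plaquette d L) (s : Fin 4), plaqSlot p s ∈ Λ k ∧
        c ≤ dist (plaquetteHolonomy U p.1 p.2.1.1 p.2.1.2) 1} ≤ M) → ∀ n : ℕ,
        P {ω | connectedComponentIn
              {W | ∀ p : Plaquette d L, dist (plaquetteHolonomy W p.1 p.2.1.1 p.2.1.2) 1 < ε} (Z n ω) ≠
            connectedComponentIn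
              {W | ∀ p : Plaquette d L, dist (plaquetteHolonomy W p.1 p.2.1.1 p.2.1.2) 1 < ε} (Z 0 ω)} ≤
          n * (2 * M) := by
  obtain ⟨r₀, hr₀, hpath⟩ := exists_localPaths_radius (N := N)
  refine ⟨r₀, hr₀, fun c ε hc0 hc hcε d L Λ hΛ Ω _ P Z hZ m hmarg hstep M hM n => ?_⟩
  exact Lattice.measure_sector_ne_le_nsteps_of_exposedLinks dist_mul_left dist_mul_right (r := 2 * c)
    (by linarith) (hpath (2 * c) hc) (le_refl _) (by linarith) hΛ P Z hZ m hmarg hstep hM n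

end Summit.Ventures.LatticeQCDFlow.Theory2.Lattice.SUN

/-! ## §3. `U(N)`: the explicit threshold `c ≤ min(ε/17, 1/16)` -/

namespace Summit.Ventures.LatticeQCDFlow.Theory2.Lattice.UN

open Summit.Ventures.LatticeQCDFlow.Theory2.Lattice
open Literature.MathematicalPhysics.QuantumFieldTheory.UnitaryCayley (𝔾)

variable {N : ℕ}

/-- **`U(N)` slab tunnelling law with an explicit threshold** (`0 ≤ c ≤ 1/16`, `17c ≤ ε`; Cayley
`(2c, 4c)`-local paths). [folklore] -/
theorem compProd_sector_ne_le_of_slab {c ε : ℝ} (hc0 : 0 ≤ c) (hc : c ≤ 1 / 16) (hcε : 17 * c ≤ ε)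
    {d L : ℕ} [NeZero L] (hL : 2 ≤ L) (l : Fin d) (a : ZMod L) {Λ : Set (Edge d L)}
    (hΛ : ∀ e ∈ Λ, e.2 ≠ l ∧ e.1 l = a)
    (μ : Measure (GaugeConfig d L (𝔾 N))) [SFinite μ]
    (κ : Kernel (GaugeConfig d L (𝔾 N)) (GaugeConfig d L (𝔾 N))) [IsMarkovKernel κ] (hinv : κ.Invariant μ)
    (hmove : ∀ᵐ q ∂(μ ⊗ₘ κ), ∀ e ∉ Λ, q.1 e = q.2 e) :
    (μ ⊗ₘ κ) {q | connectedComponentIn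
          {W : GaugeConfig d L (𝔾 N) | ∀ p : Plaquette d L, dist (plaquetteHolonomy W p.1 p.2.1.1 p.2.1.2) 1 < ε} q.1 ≠
        connectedComponentIn
          {W : GaugeConfig d L (𝔾 N) | ∀ p : Plaquette d L, dist (plaquetteHolonomy W p.1 p.2.1.1 p.2.1.2) 1 < ε} q.2} ≤
      2 * μ {U | ∃ (p : Plaquette d L) (s : Fin 4), plaqSlot p s ∈ Λ ∧
        c ≤ dist (plaquetteHolonomy U p.1 p.2.1.1 p.2.1.2) 1} :=
  Lattice.compProd_sector_ne_le_of_slab hL dist_mul_left dist_mul_right (ρ := 2 * c) (r := 2 * (2 * c))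
    (by positivity) (fun g g' h => exists_localPaths (by positivity) (by linarith) g g' h) (le_refl _)
    (by linarith) l a hΛ μ κ hinv hmove

end Summit.Ventures.LatticeQCDFlow.Theory2.Lattice.UN
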